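import Literature.Computability.Cryptography.BLPRSSection4Params
import Literature.Computability.Cryptography.BLPRSRateGrid
import Mathlib.Analysis.Real.Pi.Bounds
import HarnessLib

/-!
# BLPRS 2013, §3–§4 in the regime of pqc.S21, II: the π-free parameters of the finite-precision machine (radius and rate grid)

Topic `Computability/Cryptography` (LWE), grouping namespace `BLPRS2013`; sequel of `BLPRSSection4Params.lean`
(the parameters of the law-level chain with the EXACT guesses `guessRaise`) and of `BLPRSRateGrid.lean` (the grid
of raisings `gridTau`, one of which almost hits the target rate). A coin-driven machine samples the discrete
Gaussians of the modulus switch by GPV's rejection sampler with a RATIONAL `θ` (width `√(π/θ)`) and multiplies its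
pseudo-Gaussian by a RATIONAL `κ`; this file fixes the corresponding integer/rational parameter functions of `n`
and proves their admissibility for all large `n` (everything PROVED, definitions with bodies, no named fact):

* `gridA c n = ⌊√(n(c+1)(⌊log₂ n⌋+2))⌋ + 1` (an INTEGER), `gridTheta c n = n/A² ∈ ℚ ∩ (0,1]`
  (`gridTheta_pos`, `gridTheta_le_one`), the radius `gridRadius q c n = √(π/θ)/q = √π·A/(√n·q)`
  (`gridRadius_eq`, `gridRadius_sq`), and **`multiplier_base`**: `q·r·√n/√π = A` — the base multiplier `κ₀`
  of `BLPRSRateGrid.lean` is the integer `A`, so the machine's multipliers `A + i/D` are rational;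
* **`switchRadius_le_gridRadius`** (`n ≥ 4`: the smoothing hypothesis of Cor. 3.2 still holds,
  `2n·ln(2n(1+n^c)) ≤ π²A²`) and **`eventually_grid_budget`** (`(5α₂² + r_A²)·2n ≤ α²`: the radius stays inside
  the noise budget, `2πA²/q² ≤ 48π(c+1)·n ln n/q² ≤ α²/2` once `48π(c+1)+… ≤ ln n`);
* `gridD c_D n = 8n^{c_D}`, `gridG q c_D n = q·D + 1` and **`eventually_grid_guess`** — for all large `n` and every
  binary `z`, some guess `i < G` has switched-and-raised rate `a ≤ α` with
  `Δ(Ψ̄_{q}(a), Ψ̄_{q}(α)) ≤ 8√π/(D·q·α)` (`exists_gridTau_tvDist_le` with the budget above).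

## References

* Z. Brakerski, A. Langlois, C. Peikert, O. Regev, D. Stehlé, *Classical hardness of learning with errors*, STOC 2013;
  arXiv:1306.0281, p. 13 (parameters of the formal Thm. 1.1; `β² = 10nα² + (4n/(πq'²))ln(2n(1+1/ξ)) ≤ α²`),
  Cor. 3.2, Lemma 2.15, §5 (finite precision). [BrakerskiEtAl2013]
* O. Regev, *On lattices, learning with errors …*, J. ACM 56 (2009), Claim 2.2, Lemma 3.7 (proof). [RegevLWE2009]
-/

noncomputable section

open Filter Literature.Algebra.EuclideanLattices Literature.Computability.Complexity
open scoped Real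

namespace Literature.Computability.Cryptography

namespace BLPRS2013

open LWE

/-! ### The integer `A`, the rational `θ`, the radius -/

section Radius

variable {q : ℕ → ℕ} {α : ℕ → ℝ}

/-- **The integer `A = ⌊√(n(c+1)(⌊log₂ n⌋+2))⌋ + 1`** (so that `n(c+1)(⌊log₂ n⌋+2) < A²`). [cite: BrakerskiEtAl2013, p. 13 with §5] -/
def gridA (c n : ℕ) : ℕ := Nat.sqrt (n * (c + 1) * (Nat.log 2 n + 2)) + 1

/-- **The rational `θ = n/A²`** of the rejection sampler (width `√(π/θ) = √π·A/√n = q·r`). [cite: BrakerskiEtAl2013, §5] -/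
def gridTheta (c n : ℕ) : ℚ := (n : ℚ) / ((gridA c n : ℚ) ^ 2)

variable (q) in
/-- **The radius of the switch**, `r = √(π/θ)/q`. [cite: BrakerskiEtAl2013, Cor. 3.2 and p. 13] -/
def gridRadius (c n : ℕ) : ℝ := Real.sqrt (π / (gridTheta c n : ℝ)) / q n

/-- `A ≥ 1`. [folklore] -/
theorem gridA_pos (c n : ℕ) : 0 < gridA c n := Nat.succ_pos _

/-- `n(c+1)(⌊log₂ n⌋+2) < A²`. [folklore] -/
theorem lt_gridA_sq (c n : ℕ) : n * (c + 1) * (Nat.log 2 n + 2) < gridA c n ^ 2 :=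
  Nat.lt_succ_sqrt' _

/-- `n ≤ A²` (indeed `n < A²`). [folklore] -/
theorem le_gridA_sq (c n : ℕ) : n ≤ gridA c n ^ 2 := by
  have h := lt_gridA_sq c n
  have h1 : n ≤ n * (c + 1) * (Nat.log 2 n + 2) := by
    calc n = n * 1 * 1 := by ring
      _ ≤ n * (c + 1) * (Nat.log 2 n + 2) := by gcongr <;> omega
  omega

/-- `A² ≤ 4·n(c+1)(⌊log₂ n⌋+2)` for `n ≥ 1` (`(⌊√X⌋+1)² ≤ 4X` for `X ≥ 1`). [folklore] -/
theorem gridA_sq_le {c n : ℕ} (hn : 1 ≤ n) : gridA c n ^ 2 ≤ 4 * (n * (c + 1) * (Nat.log 2 n + 2)) := by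
  set X := n * (c + 1) * (Nat.log 2 n + 2) with hX
  have hX1 : 1 ≤ X := by
    rw [hX]
    calc 1 = 1 * 1 * 1 := by ring
      _ ≤ n * (c + 1) * (Nat.log 2 n + 2) := by gcongr <;> omega
  have hs : Nat.sqrt X ^ 2 ≤ X := Nat.sqrt_le' X
  have hs1 : 1 ≤ Nat.sqrt X := Nat.le_sqrt.2 (by simpa using hX1)
  unfold gridA
  rw [← hX]
  nlinarith

/-- `θ` as a real number. [folklore] -/
theorem cast_gridTheta (c n : ℕ) : ((gridTheta c n : ℚ) : ℝ) = (n : ℝ) / (gridA c n : ℝ) ^ 2 := by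
  unfold gridTheta; push_cast; ring

/-- **`0 < θ`** for `n ≥ 1`. [folklore] -/
theorem gridTheta_pos {c n : ℕ} (hn : 0 < n) : 0 < gridTheta c n := by
  unfold gridTheta
  have hA : (0 : ℚ) < gridA c n := by exact_mod_cast gridA_pos c n
  positivity

/-- **`θ ≤ 1`** (`n ≤ A²`; the rejection sampler's hypothesis). [folklore] -/
theorem gridTheta_le_one (c n : ℕ) : gridTheta c n ≤ 1 := by
  unfold gridTheta
  have hA : (0 : ℚ) < (gridA c n : ℚ) ^ 2 := by
    have : (0 : ℚ) < gridA c n := by exact_mod_cast gridA_pos c n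
    positivity
  rw [div_le_one hA]
  exact_mod_cast le_gridA_sq c n

/-- **`r = √π·A/(√n·q)`** (`n ≥ 1`). [folklore] -/
theorem gridRadius_eq {c n : ℕ} (hn : 0 < n) : gridRadius q c n = √π * gridA c n / (Real.sqrt n * q n) := by
  have hn' : (0 : ℝ) < n := by exact_mod_cast hn
  have hA : (0 : ℝ) < gridA c n := by exact_mod_cast gridA_pos c n
  unfold gridRadius
  rw [cast_gridTheta]
  have e : π / ((n : ℝ) / (gridA c n : ℝ) ^ 2) = π * (gridA c n : ℝ) ^ 2 / n := by field_simp
  rw [e, Real.sqrt_div' _ hn'.le, Real.sqrt_mul Real.pi_pos.le, Real.sqrt_sq hA.le]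
  field_simp

/-- `r² = πA²/(n q²)` (`n ≥ 1`). [folklore] -/
theorem gridRadius_sq {c n : ℕ} (hn : 0 < n) : gridRadius q c n ^ 2 = π * (gridA c n : ℝ) ^ 2 / (n * (q n : ℝ) ^ 2) := by
  have hn' : (0 : ℝ) < n := by exact_mod_cast hn
  rw [gridRadius_eq hn, div_pow, mul_pow, mul_pow, Real.sq_sqrt Real.pi_pos.le, Real.sq_sqrt hn'.le]

/-- `0 ≤ r`. [folklore] -/
theorem gridRadius_nonneg (c n : ℕ) : 0 ≤ gridRadius q c n := by
  unfold gridRadius; positivity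

/-- **The base multiplier is the integer `A`**: `q·r·√n/√π = A` (`n ≥ 1`, `q(n) ≥ 1`), so the machine's
multipliers `κ₀ + i/D = A + i/D` are rational. [cite: BrakerskiEtAl2013, §5] -/
theorem multiplier_base {c n : ℕ} (hn : 0 < n) (hq : 0 < q n) :
    (q n : ℝ) * gridRadius q c n * Real.sqrt n / √π = gridA c n := by
  have hn' : (0 : ℝ) < n := by exact_mod_cast hn
  have hq' : (0 : ℝ) < q n := by exact_mod_cast hq
  have hsn : (0 : ℝ) < Real.sqrt n := Real.sqrt_pos.2 hn'
  have hsπ : (0 : ℝ) < √π := Real.sqrt_pos.2 Real.pi_pos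
  rw [gridRadius_eq hn]
  field_simp

/-! ### The smoothing hypothesis and the noise budget -/

/-- `ln n ≤ 0.7·(⌊log₂ n⌋ + 1)` (`n ≥ 1`; `n < 2^{⌊log₂ n⌋+1}`, `ln 2 < 0.7`). [folklore] -/
theorem log_le_natLog (n : ℕ) (hn : 0 < n) : Real.log n ≤ 0.7 * ((Nat.log 2 n : ℝ) + 1) := by
  have hlt : n < 2 ^ (Nat.log 2 n + 1) := Nat.lt_pow_succ_log_self (by norm_num) n
  have hlt' : (n : ℝ) < (2 : ℝ) ^ (Nat.log 2 n + 1) := by exact_mod_cast hlt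
  have hn' : (0 : ℝ) < n := by exact_mod_cast hn
  have h1 : Real.log n ≤ Real.log ((2 : ℝ) ^ (Nat.log 2 n + 1)) := Real.log_le_log hn' hlt'.le
  rw [Real.log_pow] at h1
  have h2 := Real.log_two_lt_d9
  have h3 : (0 : ℝ) ≤ ((Nat.log 2 n + 1 : ℕ) : ℝ) := by positivity
  calc Real.log n ≤ (Nat.log 2 n + 1 : ℕ) * Real.log 2 := h1
    _ ≤ (Nat.log 2 n + 1 : ℕ) * 0.7 := mul_le_mul_of_nonneg_left (by linarith) h3
    _ = 0.7 * ((Nat.log 2 n : ℝ) + 1) := by push_cast; ring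

/-- `⌊log₂ n⌋ ≤ 1.45·ln n` (`n ≥ 1`; `2^{⌊log₂ n⌋} ≤ n`, `ln 2 > 0.69`). [folklore] -/
theorem natLog_le_log (n : ℕ) (hn : 0 < n) : (Nat.log 2 n : ℝ) ≤ 1.45 * Real.log n := by
  have hle : 2 ^ Nat.log 2 n ≤ n := Nat.pow_log_le_self 2 hn.ne'
  have hle' : (2 : ℝ) ^ Nat.log 2 n ≤ n := by exact_mod_cast hle
  have h1 : Real.log ((2 : ℝ) ^ Nat.log 2 n) ≤ Real.log n := Real.log_le_log (by positivity) hle'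
  rw [Real.log_pow] at h1
  have h2 := Real.log_two_gt_d9
  have h3 : (0 : ℝ) ≤ Nat.log 2 n := by positivity
  nlinarith

/-- `ln(2n(1+n^c)) ≤ (c+3)·ln n` for `n ≥ 4` (the estimate inside `eventually_modSwitch_budget`). [folklore] -/
theorem log_switch_le {c n : ℕ} (h4 : 4 ≤ n) : Real.log (2 * n * (1 + (n : ℝ) ^ c)) ≤ (c + 3) * Real.log n := by
  have hn4 : (4 : ℝ) ≤ n := by exact_mod_cast h4
  have hin : 2 * (n : ℝ) * (1 + (n : ℝ) ^ c) ≤ (n : ℝ) ^ (c + 3) := by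
    have h1 : 1 + (n : ℝ) ^ c ≤ 2 * (n : ℝ) ^ c := by
      have : 1 ≤ (n : ℝ) ^ c := one_le_pow₀ (by linarith)
      linarith
    have h3 : 4 * (n : ℝ) ^ (c + 1) ≤ (n : ℝ) ^ (c + 3) := by
      rw [show (n : ℝ) ^ (c + 3) = (n : ℝ) ^ (c + 1) * (n * n) by ring]
      have h0 : (0 : ℝ) ≤ (n : ℝ) ^ (c + 1) := by positivity
      have h16 : (4 : ℝ) ≤ n * n := by nlinarith
      nlinarith [mul_le_mul_of_nonneg_left h16 h0]
    calc 2 * (n : ℝ) * (1 + (n : ℝ) ^ c) ≤ 2 * (n : ℝ) * (2 * (n : ℝ) ^ c) :=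
          mul_le_mul_of_nonneg_left h1 (by positivity)
      _ = 4 * (n : ℝ) ^ (c + 1) := by ring
      _ ≤ (n : ℝ) ^ (c + 3) := h3
  calc Real.log (2 * n * (1 + (n : ℝ) ^ c)) ≤ Real.log ((n : ℝ) ^ (c + 3)) := Real.log_le_log (by positivity) hin
    _ = (c + 3) * Real.log n := by rw [Real.log_pow]; push_cast; ring

/-- **The smoothing hypothesis of the switch survives**: `switchRadius ≤ gridRadius` for `n ≥ 4` and `q(n) ≥ 1`
(`2·ln(2n(1+n^c))/π ≤ π·A²/n` since `2n(c+3)ln n ≤ 6n(c+1)ln n ≤ π²·n(c+1)(⌊log₂ n⌋+2) < π²A²`).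
[cite: BrakerskiEtAl2013, Cor. 3.2 (hypothesis on `r`)] -/
theorem switchRadius_le_gridRadius {c n : ℕ} (h4 : 4 ≤ n) (hq : 0 < q n) : switchRadius q c n ≤ gridRadius q c n := by
  have hn : 0 < n := by omega
  have hn' : (0 : ℝ) < n := by exact_mod_cast hn
  have hq' : (0 : ℝ) < q n := by exact_mod_cast hq
  have hπ := Real.pi_pos
  have hlog0 : 0 < Real.log n := Real.log_pos (by exact_mod_cast (by omega : 1 < n))
  -- compare the squares of the `q`-free parts
  have hkey : 2 * Real.log (2 * n * (1 + (n : ℝ) ^ c)) / π ≤ π * (gridA c n : ℝ) ^ 2 / n := by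
    rw [div_le_div_iff₀ hπ hn']
    have hA : (n : ℝ) * (c + 1) * ((Nat.log 2 n : ℝ) + 2) < (gridA c n : ℝ) ^ 2 := by exact_mod_cast lt_gridA_sq c n
    have hL := log_le_natLog n hn
    have hls := log_switch_le (c := c) h4
    have hπ2 : (9.8 : ℝ) ≤ π * π := by nlinarith [Real.pi_gt_d2]
    have hc3 : ((c : ℝ) + 3) ≤ 3 * ((c : ℝ) + 1) := by linarith [(Nat.cast_nonneg c : (0 : ℝ) ≤ c)]
    -- `2 ln(…) n ≤ 2(c+3) n ln n ≤ 6(c+1) n · 0.7 (L+1) ≤ 9.8 (c+1) n (L+2) ≤ π² A²`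
    have h1 : 2 * Real.log (2 * n * (1 + (n : ℝ) ^ c)) * n ≤ 2 * ((c + 3) * Real.log n) * n := by
      have := mul_le_mul_of_nonneg_left hls (by positivity : (0 : ℝ) ≤ 2 * n)
      nlinarith
    have h2 : 2 * ((c + 3) * Real.log n) * n ≤ 9.8 * ((n : ℝ) * (c + 1) * ((Nat.log 2 n : ℝ) + 2)) := by
      have hL0 : (0 : ℝ) ≤ Nat.log 2 n := by positivity
      have hc0 : (0 : ℝ) ≤ c := Nat.cast_nonneg c
      nlinarith [mul_le_mul_of_nonneg_left hL (by positivity : (0 : ℝ) ≤ (c + 1) * n),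
        mul_le_mul_of_nonneg_right hc3 (by positivity : (0 : ℝ) ≤ Real.log n * n)]
    have h3 : 9.8 * ((n : ℝ) * (c + 1) * ((Nat.log 2 n : ℝ) + 2)) ≤ π * (gridA c n : ℝ) ^ 2 * π := by
      nlinarith [mul_le_mul_of_nonneg_left hA.le (by positivity : (0 : ℝ) ≤ π * π)]
    linarith
  have hsq : Real.sqrt (2 * Real.log (2 * n * (1 + (n : ℝ) ^ c)) / π) ≤ Real.sqrt (π * (gridA c n : ℝ) ^ 2 / n) :=
    Real.sqrt_le_sqrt hkey
  have hrhs : gridRadius q c n = ((q n : ℝ))⁻¹ * Real.sqrt (π * (gridA c n : ℝ) ^ 2 / n) := by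
    unfold gridRadius
    rw [cast_gridTheta]
    have e : π / ((n : ℝ) / (gridA c n : ℝ) ^ 2) = π * (gridA c n : ℝ) ^ 2 / n := by
      have hA0 : (0 : ℝ) < gridA c n := by exact_mod_cast gridA_pos c n
      field_simp
    rw [e, div_eq_inv_mul]
  rw [hrhs, switchRadius]
  exact mul_le_mul_of_nonneg_left hsq (by positivity)

/-- **The radius stays inside the noise budget**: eventually `(5α₂² + r_A²)·2n ≤ α²`
(`2n·r_A² = 2πA²/q² ≤ 8π(c+1)(⌊log₂ n⌋+2)·n/q² ≤ 48π(c+1)·n ln n/q² ≤ α²/2` once `96π(c+1) ≤ ln n`, using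
`(αq)² ≥ n ln² n`; the `binLWE` part by `eventually_noise_budget`). [cite: BrakerskiEtAl2013, p. 13 (`β² ≤ α²`)] -/
theorem eventually_grid_budget (c : ℕ)
    (hα : ∀ᶠ n : ℕ in atTop, 0 < α n ∧ α n < 1 ∧ Real.sqrt n * Real.log n ≤ α n * q n) :
    ∀ᶠ n : ℕ in atTop, (5 * rate₂ α n ^ 2 + gridRadius q c n ^ 2) * (2 * n) ≤ α n ^ 2 := by
  have hlog : ∀ᶠ n : ℕ in atTop, 96 * π * (c + 1) ≤ Real.log n :=
    (Real.tendsto_log_atTop.comp tendsto_natCast_atTop_atTop).eventually_ge_atTop _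
  filter_upwards [eventually_noise_budget α, hα, hlog, eventually_inv_rate_le hα, eventually_ge_atTop 4]
    with n h1 hαn hlogn hinv h4
  obtain ⟨hα0, -, h1αq, -⟩ := hinv
  have hn : 0 < n := by omega
  have hn' : (0 : ℝ) < n := by exact_mod_cast hn
  have hn4 : (4 : ℝ) ≤ n := by exact_mod_cast h4
  have hq0 : (0 : ℝ) < q n := by
    by_contra h; push Not at h; nlinarith
  have hπ := Real.pi_pos
  have hlog0 : 0 < Real.log n := Real.log_pos (by linarith)
  -- `A² ≤ 4n(c+1)(L+2) ≤ 4n(c+1)·3 ln n`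
  have hA : ((gridA c n : ℕ) : ℝ) ^ 2 ≤ 4 * ((n : ℝ) * (c + 1) * ((Nat.log 2 n : ℝ) + 2)) := by
    exact_mod_cast gridA_sq_le (c := c) (by omega : 1 ≤ n)
  have hL : (Nat.log 2 n : ℝ) + 2 ≤ 3 * Real.log n := by
    have h := natLog_le_log n hn
    have hl4 : (1.38 : ℝ) ≤ Real.log n := by
      have := Real.log_le_log (by norm_num : (0 : ℝ) < 4) hn4
      have h4' : (1.38 : ℝ) ≤ Real.log 4 := by
        rw [show (4 : ℝ) = 2 ^ 2 by norm_num, Real.log_pow]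
        have := Real.log_two_gt_d9
        push_cast
        linarith
      linarith
    linarith
  have hr2 : gridRadius q c n ^ 2 * (2 * n) = 2 * π * (gridA c n : ℝ) ^ 2 / (q n : ℝ) ^ 2 := by
    rw [gridRadius_sq hn]
    field_simp
  have hsw : gridRadius q c n ^ 2 * (2 * n) ≤ α n ^ 2 / 2 := by
    rw [hr2, div_le_div_iff₀ (by positivity) (by norm_num : (0 : ℝ) < 2)]
    -- `(αq)² ≥ n ln² n ≥ 96π(c+1) n ln n ≥ 4π A²`
    have hsq : n * Real.log n ^ 2 ≤ (α n * q n) ^ 2 := by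
      have h := pow_le_pow_left₀ (by positivity) hαn.2.2 2
      rwa [mul_pow, Real.sq_sqrt hn'.le] at h
    have hc0 : (0 : ℝ) ≤ c := Nat.cast_nonneg c
    have h3 : (gridA c n : ℝ) ^ 2 ≤ 12 * (c + 1) * (n * Real.log n) := by
      calc (gridA c n : ℝ) ^ 2 ≤ 4 * ((n : ℝ) * (c + 1) * ((Nat.log 2 n : ℝ) + 2)) := hA
        _ ≤ 4 * ((n : ℝ) * (c + 1) * (3 * Real.log n)) := by gcongr
        _ = 12 * (c + 1) * (n * Real.log n) := by ring
    have h4' : 96 * π * (c + 1) * (n * Real.log n) ≤ n * Real.log n ^ 2 := by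
      have := mul_le_mul_of_nonneg_left hlogn (by positivity : (0 : ℝ) ≤ n * Real.log n)
      nlinarith
    calc 2 * π * (gridA c n : ℝ) ^ 2 * 2 ≤ 2 * π * (12 * (c + 1) * (n * Real.log n)) * 2 := by gcongr
      _ = (96 * π * (c + 1) * (n * Real.log n)) / 2 := by ring
      _ ≤ (n * Real.log n ^ 2) / 2 := by gcongr
      _ ≤ (α n * q n) ^ 2 / 2 := by gcongr
      _ = α n ^ 2 * (q n : ℝ) ^ 2 / 2 := by ring
      _ ≤ α n ^ 2 * (q n : ℝ) ^ 2 := by nlinarith [sq_nonneg (α n * q n)]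
  have h5 : 5 * rate₂ α n ^ 2 * (2 * n) ≤ α n ^ 2 / 2 := by nlinarith [h1]
  nlinarith [hsw, h5]

end Radius

/-! ### The grid sizes and the good guess -/

section Guess

variable {q : ℕ → ℕ} {α : ℕ → ℝ}

/-- **The grid fineness `D = 8n^{c_D}`** (`≥ 8`, so that `4√π/(Dq) ≤ α` as soon as `αq ≥ 1`). [cite: RegevLWE2009, Lemma 3.7 (proof: the grid)] -/
def gridD (cD n : ℕ) : ℕ := 8 * n ^ cD

variable (q) in
/-- **The number of guesses `G = q·D + 1`** (`≥ qαD/√π + 1`). [cite: BrakerskiEtAl2013, Lemma 2.15; RegevLWE2009, Lemma 3.7 (proof)] -/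
def gridG (cD n : ℕ) : ℕ := q n * gridD cD n + 1

/-- `D ≥ 8 > 0` for `n ≥ 1`. [folklore] -/
theorem gridD_ge {cD n : ℕ} (hn : 0 < n) : 8 ≤ gridD cD n := by
  unfold gridD
  have : 1 ≤ n ^ cD := Nat.one_le_pow _ _ hn
  omega

/-- `G > 0`. [folklore] -/
theorem gridG_pos (cD n : ℕ) : 0 < gridG q cD n := Nat.succ_pos _

/-- **For all large `n`, every binary secret has a good guess on the grid**: some `i < G` makes the
switched-and-raised rate `a = √(√(ρ₀(z̄)² + r²(‖z‖² + n))² + τᵢ²)` (raisings `τ = gridTau q A D G`,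
`ρ₀ = binNoiseRate`, `‖z‖ ≤ √n`) satisfy `a ≤ α` and `Δ(Ψ̄_q(a), Ψ̄_q(α)) ≤ 8√π/(D·q·α)`.
[cite: BrakerskiEtAl2013, p. 13 with Lemma 2.15 and §5; RegevLWE2009, Claim 2.2, Lemma 3.7 (proof)] -/
theorem eventually_grid_guess [∀ n, NeZero (q n)] (c cD : ℕ)
    (hα : ∀ᶠ n : ℕ in atTop, 0 < α n ∧ α n < 1 ∧ Real.sqrt n * Real.log n ≤ α n * q n) :
    ∀ᶠ n : ℕ in atTop, ∀ z : Fin n → ℤ, (∀ j, z j = 0 ∨ z j = 1) →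
      ∃ i : Fin (gridG q cD n),
        Real.sqrt (Real.sqrt (binNoiseRate α n (intCastVec z) ^ 2 +
              gridRadius q c n ^ 2 * (‖intVecToEuclidean n z‖ ^ 2 + Real.sqrt n ^ 2)) ^ 2 +
            gridTau (q n) ((q n : ℝ) * gridRadius q c n * Real.sqrt n / √π) (gridD cD n) (gridG q cD n) i ^ 2) ≤ α n ∧
        (discretizedGaussian (q n) (Real.sqrt (Real.sqrt (binNoiseRate α n (intCastVec z) ^ 2 +
              gridRadius q c n ^ 2 * (‖intVecToEuclidean n z‖ ^ 2 + Real.sqrt n ^ 2)) ^ 2 +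
            gridTau (q n) ((q n : ℝ) * gridRadius q c n * Real.sqrt n / √π) (gridD cD n) (gridG q cD n) i ^ 2))).tvDist
          (discretizedGaussian (q n) (α n)) ≤ 8 * √π / (gridD cD n * q n * α n) := by
  filter_upwards [eventually_grid_budget c hα, eventually_inv_rate_le hα, eventually_ge_atTop 1] with n hbud hinv h1 z hz
  obtain ⟨hα0, hα1, h1αq, -⟩ := hinv
  have hn : 0 < n := h1
  have hn' : (0 : ℝ) < n := by exact_mod_cast hn
  have hq0 : (0 : ℝ) < q n := by
    by_contra h; push Not at h; nlinarith
  have hD8 : 8 ≤ gridD cD n := gridD_ge hn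
  have hD : 0 < gridD cD n := by omega
  have hD' : (8 : ℝ) ≤ gridD cD n := by exact_mod_cast hD8
  have hsπ : (0 : ℝ) < √π := Real.sqrt_pos.2 Real.pi_pos
  have hsπ4 : √π ≤ 2 := by
    rw [Real.sqrt_le_left (by norm_num)]
    linarith [Real.pi_lt_d2]
  -- the budget for this `z`: `ρ₀² + r²(‖z‖² + n) ≤ (5α₂² + r²)·2n ≤ α²`
  have hnorm : ‖intVecToEuclidean n z‖ ^ 2 ≤ n := by
    have h := norm_intVecToEuclidean_le_sqrt_of_binary hz
    calc ‖intVecToEuclidean n z‖ ^ 2 ≤ Real.sqrt n ^ 2 := pow_le_pow_left₀ (norm_nonneg _) h 2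
      _ = n := Real.sq_sqrt hn'.le
  have hρsq : binNoiseRate α n (intCastVec z) ^ 2 ≤ 5 * rate₂ α n ^ 2 * (2 * n) := by
    rw [binNoiseRate_sq]
    have hw : (hammingNorm (intCastVec z : Fin n → ZMod (modulus n)) : ℝ) ≤ n := by
      exact_mod_cast (hammingNorm_le_card_fintype).trans_eq (Fintype.card_fin n)
    have : (0 : ℝ) ≤ 5 * rate₂ α n ^ 2 := by positivity
    nlinarith
  have hbudget : binNoiseRate α n (intCastVec z) ^ 2 +
      gridRadius q c n ^ 2 * (‖intVecToEuclidean n z‖ ^ 2 + Real.sqrt n ^ 2) ≤ α n ^ 2 := by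
    rw [Real.sq_sqrt hn'.le]
    have hr0 : 0 ≤ gridRadius q c n ^ 2 := sq_nonneg _
    nlinarith [mul_le_mul_of_nonneg_left hnorm hr0]
  -- the grid hypotheses
  have hG : (q n : ℝ) * α n * (gridD cD n) / √π + 1 ≤ gridG q cD n := by
    unfold gridG
    push_cast
    have h1' : (q n : ℝ) * α n * (gridD cD n) / √π ≤ (q n : ℝ) * (gridD cD n) := by
      rw [div_le_iff₀ hsπ]
      have hs1 : (1 : ℝ) ≤ √π := by
        rw [Real.le_sqrt (by norm_num) Real.pi_pos.le]
        linarith [Real.pi_gt_three]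
      have : (q n : ℝ) * α n * (gridD cD n) ≤ (q n : ℝ) * 1 * (gridD cD n) := by gcongr
      nlinarith [mul_nonneg hq0.le (by positivity : (0 : ℝ) ≤ gridD cD n)]
    linarith
  have hDα : 4 * √π / ((gridD cD n : ℝ) * q n) ≤ α n := by
    rw [div_le_iff₀ (by positivity)]
    calc 4 * √π ≤ 4 * 2 := by gcongr
      _ ≤ (gridD cD n : ℝ) * 1 := by linarith
      _ ≤ (gridD cD n : ℝ) * (α n * q n) := mul_le_mul_of_nonneg_left h1αq (by positivity)
      _ = α n * ((gridD cD n : ℝ) * q n) := by ring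
  exact exists_gridTau_tvDist_le (gridRadius_nonneg c n) (Real.sqrt_nonneg _) (sq_nonneg _) hα0 hbudget hD hG hDα

end Guess

end BLPRS2013

end Literature.Computability.Cryptography

end
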